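import Summits.AtomisticToContinuum.BoseEinsteinCondensation.Theorems.BECThomsonPrincipleGDTransferSeededPlainPairCostInt
import Summits.AtomisticToContinuum.BoseEinsteinCondensation.Theorems.BECThomsonPrincipleGDTransferSeededIntegrableDefs
import Summits.AtomisticToContinuum.BoseEinsteinCondensation.Theorems.BECThomsonPrincipleGDTransferSeededWeightedWindowLaw
import Summits.AtomisticToContinuum.BoseEinsteinCondensation.Theorems.BECThomsonPrincipleGDTransferSeededBandFromWindow

/-!
# Route `BECThomsonPrinciple`, crux `GDTransfer` (stmt-AtomisticToContinuum-9482), line `seeded-continuity`: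
# stub `stub_bandEmptinessInt` (skeleton v7) — Gaussian domination empties the middle band, SQUARE-INTEGRABLE profiles

Closes the registered stub `stub_bandEmptinessInt : Sig.stub_bandEmptinessInt` of skeleton v7,
`GaussianDominationCan → ∀ v, IsRepulsiveFiniteRange v → IsSqIntegrableProfile v → BandEmptiness v`: the landed
plain-pair dichotomy `gd_bandEmptiness` / `stub_bandEmptinessBdd` re-run for admissible profiles that are FINITE on
`[0, ∞)` with SQUARE-INTEGRABLE radial lift — integrable singular cores such as `r⁻¹𝟙[r ≤ R]`, no hard core.
Boundedness entered the bounded twin round (`…SeededPlainFormsBdd`, `…PlainPairsBdd`, `…PlainInteractionBdd`,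
`…PlainPairCostBdd`) only QUALITATIVELY: as integrability / Fubini bookkeeping of the pair weight
`X ↦ v^per(x_p − x_q)` against bounded continuous states on the compact cell, as finiteness of the periodisation
(`toReal` sums) and as `‖v‖₁ < ∞`; the cost constant `8(‖v‖₁ + √‖v‖₁) + 1` sees only `‖v‖₁`.  Parts 1–4
(`…SeededPlainFormsInt`, `…SeededPlainPairsInt`, `…SeededPlainInteractionInt`, `…SeededPlainPairCostInt`) re-prove
exactly the boundedness-consuming theorems for a pair weight in `L¹(cell^N)` (the one new analytic leaf being the
self-adjointness of the cell average `P_i` with one INTEGRABLE entry, and the one new computation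
`∫_{cell^N} v^per(x_p − x_q) = L⁻³‖v‖₁|cell^N|`), under: `v` finite on `[0, ∞)` (⇒ `v^per_L < ∞` everywhere) and
`‖v‖₁ < ∞` — which a square-integrable finite-range profile has (`lintegral_le_of_sq`).  Here the glue: the plain pair
is a weighted witness family for every such profile (`weightedFamily_of_plain_int`, verbatim
`weightedFamily_of_plain_bdd` over `plainPairAlgebra_int` + `plainPairCost_int`), and then, exactly as
`projectedDichotomy_of` / `stub_bandEmptinessBdd`, GD ⟶ `stub_chordVariation` (two-sided dual norm) ⟶
`stub_weightedWindowLaw` (weighted window bound) ⟶ `stub_bandFromWindow` (counting) gives band emptiness — none of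
which mentions the profile's regularity.

References: KennedyLiebShastry1988 (IR bound ⇒ order); LSSY2005 §1.2, Thm 2.2, Ch. 5, App. A; arXiv:1211.2778 §2.
-/

noncomputable section

open MeasureTheory Filter
open scoped ENNReal NNReal

namespace Summit.AtomisticToContinuum.BoseEinsteinCondensation.Cruxes.GDTransfer.Seeded

open Literature.MathematicalPhysics.QuantumManyBody.BoseGas
open Summit.AtomisticToContinuum.BoseEinsteinCondensation.Theses.BECThomsonPrinciple
open Summit.AtomisticToContinuum.BoseEinsteinCondensation.Theorems.GaussianDominationCan.Negative (InWindow)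
open Summit.AtomisticToContinuum.BoseEinsteinCondensation.Cruxes.GDTransfer.DysonDressedWitness
  (IsDirection mass eform windowSum windowSum_zero stub_chordVariation)

/-- **The plain pair is a weighted witness family for every admissible profile finite on `[0, ∞)` with integrable
lift** (glue; constants `ρ₁ = γ = 1`, `N₁ = 0`, `R = R₀(1 + J²)(E₀ + 2)` with `J = M√ρ L/2π`, `δ = min δ_cost 1`, zero
defect) — verbatim `weightedFamily_of_plain_bdd` over `plainPairAlgebra_int` and `plainPairCost_int`. [folklore] -/
theorem weightedFamily_of_plain_int {v : ℝ → ℝ≥0∞} (hv : IsRepulsiveFiniteRange v) (hfin : ∀ r, 0 ≤ r → v r ≠ ⊤)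
    (hint : (∫⁻ x : Space, v ‖x‖) ≠ ⊤) : WeightedWitnessFamilyFor v := by
  -- adapted from `weightedFamily_of_plain_bdd` (bounded profile)
  intro M hM
  obtain ⟨c₁, c₂, hc₁, hc₂, hSV⟩ := plainPairCost_int hv hfin hint
  refine ⟨1, c₁, c₂, 1, one_pos, hc₁, hc₂, one_pos, 0, ?_⟩
  intro m _ L hL _ hE0
  obtain ⟨R₀, hR₀, hAd⟩ := plainPairAlgebra_int hv hint m hL
  obtain ⟨δ, hδ, hSVΨ⟩ := hSV m L hL hE0
  set Jr : ℝ := M * Real.sqrt (((m + 1 : ℕ) : ℝ) / L ^ 3) * L / (2 * Real.pi) with hJr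
  set E0r : ℝ := (periodicGroundStateEnergy v (m + 1) L).toReal with hE0r
  have hE0r0 : 0 ≤ E0r := ENNReal.toReal_nonneg
  have hE0eq : periodicGroundStateEnergy v (m + 1) L = ENNReal.ofReal E0r :=
    (ENNReal.ofReal_toReal hE0).symm
  set R : ℝ := R₀ * (1 + Jr ^ 2) * (E0r + 2) with hR
  have hRpos : 0 < R := by positivity
  have hR₀R : R₀ ≤ R := by
    have h1 : (1 : ℝ) ≤ (1 + Jr ^ 2) * (E0r + 2) := by nlinarith [sq_nonneg Jr, hE0r0]
    calc R₀ = R₀ * 1 := (mul_one _).symm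
      _ ≤ R₀ * ((1 + Jr ^ 2) * (E0r + 2)) := by gcongr
      _ = R := by rw [hR]; ring
  refine ⟨R, hRpos, min δ 1, lt_min hδ one_pos, ?_⟩
  intro Ψ hΨ
  have hΨδ : periodicEnergy v Ψ ≤ periodicGroundStateEnergy v (m + 1) L + δ :=
    hΨ.trans (add_le_add le_rfl (min_le_left _ _))
  have hΨ1 : periodicEnergy v Ψ + 1 ≤ ENNReal.ofReal (E0r + 2) := by
    calc periodicEnergy v Ψ + 1 ≤ periodicGroundStateEnergy v (m + 1) L + min δ 1 + 1 := by gcongr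
      _ ≤ ENNReal.ofReal E0r + 1 + 1 := by rw [hE0eq]; gcongr; exact min_le_right _ _
      _ = ENNReal.ofReal (E0r + 2) := by
          rw [add_assoc, ← one_add_one_eq_two, ENNReal.ofReal_add hE0r0 (by norm_num)]
          norm_num
  refine ⟨fun _ => 0, ?_, ?_⟩
  · rw [windowSum_zero]; exact bot_le
  · intro n _ hwin
    obtain ⟨hdirp, hdirm, h1, h2, h3, h4, h5, h6⟩ := hAd n Ψ
    have hnJ : ‖(fun j => (n j : ℝ))‖ ≤ Jr := by
      have hw : 2 * Real.pi * ‖(fun j => (n j : ℝ))‖ / L ≤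
          M * Real.sqrt (((m + 1 : ℕ) : ℝ) / L ^ 3) := hwin
      rw [div_le_iff₀ hL] at hw
      rw [hJr, le_div_iff₀ (by positivity)]
      linarith
    have heform : ∀ {e : ℝ≥0∞},
        e ≤ ENNReal.ofReal (R₀ * (1 + ‖(fun j => (n j : ℝ))‖ ^ 2)) * (periodicEnergy v Ψ + 1) →
          e ≤ ENNReal.ofReal R := by
      intro e he
      calc e ≤ ENNReal.ofReal (R₀ * (1 + ‖(fun j => (n j : ℝ))‖ ^ 2)) * (periodicEnergy v Ψ + 1) := he
        _ ≤ ENNReal.ofReal (R₀ * (1 + Jr ^ 2)) * ENNReal.ofReal (E0r + 2) := by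
            have h0 : 0 ≤ ‖(fun j => (n j : ℝ))‖ := norm_nonneg _
            gcongr
        _ = ENNReal.ofReal R := by
            rw [← ENNReal.ofReal_mul (by positivity), hR]
    refine ⟨_, _, hdirp, hdirm, h1.trans (ENNReal.ofReal_le_ofReal hR₀R),
      h2.trans (ENNReal.ofReal_le_ofReal hR₀R), heform h3, heform h4, hSVΨ Ψ hΨδ n, ?_, ?_⟩
    · simpa only [add_zero] using h5
    · simpa only [add_zero] using h6

/-- **Registered stub `stub_bandEmptinessInt` (skeleton v7 of line `seeded-continuity`, crux `GDTransfer`,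
stmt-AtomisticToContinuum-9482)**: under Gaussian domination the middle band `θN ≤ n̂₀ < (1−β)N` of the `n̂₀`-law of
near-minimisers is empty, uniformly down the density scale, for every admissible SQUARE-INTEGRABLE pair potential
(measurable, finite range, finite on `[0, ∞)`, lift `x ↦ v(|x|)` in `L²(ℝ³)` — hence in `L¹(ℝ³)`, `lintegral_le_of_sq`;
unbounded integrable cores allowed) — GD ⟶ two-sided dual norm (`stub_chordVariation`) ⟶ weighted window bound
(`stub_weightedWindowLaw` on the weighted witness family `weightedFamily_of_plain_int`) ⟶ band emptiness
(`stub_bandFromWindow`).  [folklore assembly] (KennedyLiebShastry1988; LSSY2005 Thm 2.2, App. A; arXiv:1211.2778 §2) -/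
theorem stub_bandEmptinessInt : Sig.stub_bandEmptinessInt := by
  intro hG v hv hi
  exact stub_bandFromWindow v hv
    (stub_weightedWindowLaw (stub_chordVariation hG) v hv
      (weightedFamily_of_plain_int hv hi.1 (lintegral_le_of_sq hv hi.2)))

end Summit.AtomisticToContinuum.BoseEinsteinCondensation.Cruxes.GDTransfer.Seeded

end
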